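import Mathlib
import Summits.QuantumFields.BalabanUV.Beta.EriceRemainderEnclosureHistoryAutonomyComparisonAgeCompositionStaticChainObserverRatios
import Summits.QuantumFields.BalabanUV.Beta.EriceRemainderEnclosureHistoryAutonomyComparisonAgeCompositionStaticChainAdjacentCertificate

/-!
# EriceRemainderEnclosureHistoryAutonomyComparisonAgeCompositionStaticChainPairCertificate — (E79a) THE GENERIC PAIR CERTIFICATE:
# the observer step (◆) for an ARBITRARY lattice pair `y > z`, from SYMBOLIC envelope constants and eight explicit univariate polynomial facts —
# the kernel that every geometry class (adjacent `z ≤ 15`, `q`-bands, far pairs) instantiates with its own rational constants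

Cell `pub-balaban`, β-function sub-cell, BINDER row D4 «RemainderConst leaves for Bałaban's split» (`HOME/BINDER-OWNERS.md`; owner lineage `b2b-balaban-beta-an4`;
this file by co-owner #2 lineage `b2b-balaban-beta-d4-p2`, generation 70), β-FLOW TEAM duty (1), FREEZE (0) honoured (def-free; imports (E78c) `…ObserverRatios`
(`first_order_of_corners`, `step_of_quadratic_criterion`) and (E78d) `…AdjacentCertificate` (`nonneg_affine_of_ends`, `c1_criterion_of_upper`); nothing restated).

HONEST FRAMING (page 1, verbatim and binding).  *"Discharging BetaPertH makes Bałaban's UV stability UNCONDITIONAL — a real constructive-QFT result; it is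
NOT the continuum limit and NOT the Clay problem."*  THIS FILE DISCHARGES NOTHING OF THE KIND.  Elementary real algebra — monotone substitution of envelope
constants, affine interpolation on a box — hypotheses of a census, not facts; the age profile of Bałaban's (1.22) limit functional is NOT PRINTED ([I] p. 298;
GAPS G-t4-U2-1∕-2) and NOT asserted.  Row D4 class UNCHANGED (critical-path width 0; instance 0∕1; D4 DISCHARGE NO DATE).  HONEST DEPENDENCY: continuum YM on
T⁴ ⇐ BetaPertH ∧ nine spine estimates (0/9 proved); BetaPertH ⇐ (D1) ∧ (D4) ∧ CAP+tail; G-an2-4 gates asym, D1 and NE2/3/4.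

THE POINT (census sense (α); route (N′); README `HOME/b2b-balaban-beta-d4-p2/g70/e79/README.md`).  (E78d)–(E78i) settled the binding family (adjacent pairs,
`z ≥ 16`) with the envelope constants BAKED INTO the certificate.  Every other geometry class of the observer induction — adjacent `z ≤ 15`, the non-adjacent
`q`-bands, the far pairs — is the SAME real algebra with OTHER constants.  This file states it ONCE with the constants as LETTERS: §1 `pair_m1_nonneg` (first
order: `m₁ ≥ 0` from the FOUR corner values `(P, w) ∈ {clΨ, chΨ} × {N∕L, 1}` of the minorant with envelope constants — no `w`-monotonicity is assumed, so the
far pairs, where the minorant DEcreases in the window room, are covered; (E78c) `first_order_of_corners` after monotone substitution `σ ≥ sl`, `φ ≥ fl`,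
`θ ≤ th`, `1∕q ≤ rh`), §2 `pair_c1_le` (finite load: `c₁ ≤ λm₁` from four corner values `(P, r) ∈ {clΨ, chΨ} × {rl, rh}` at the room end `w = N∕L`, via
(E78d) `c1_criterion_of_upper`), §3 **`pair_step`** (the hypothesis `hdia` of (E78a) `observer_step`, general `κ ∈ [0,1]` and `q > 0`, from the eight corner
facts, the pole polynomial `rh·L ≤ 2(slo+Ψ)N`, and the load below its cap).  Here `L = l1 + l2Ψ` (structural constants `λ₁, λ₂` of (E78b)
`return_amplification_ge_lattice`), `N = l1 + (l2 − rh)Ψ` (`= L·(1 − rh·Ω_y^max)`: the window room with the EXACT scale transfer `Ω_z = Ω_y∕q ≤ rh·Ω_y`),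
sandwich `Pyz ∈ [al, au]Ψ`, `Pzy ∈ [bl, bu]Ψ`, `Pzz ∈ [cl, ch]Ψ`, product bounds `|ΨPzz − PyzPzy| ≤ DΨ²`.  AN INSTANCE = rational constants + eight univariate
polynomial facts (for every pair computed so far — adjacent `z = 1…16`, `q` up to `4096` — ALL EIGHT HAVE ALL COEFFICIENTS POSITIVE once `D` carries the Grüss
factor `1∕4` and `θ ≤ θ̄(q)` is used; `g70/numerics/polycert2.py`, `gruss.py`) + the lattice envelope lemmas.  WHAT REMAINS (README): the generic lattice wiring
(E79c), the instances, the assembly.  NOT CLAIMED: any instance; the static closure; anything about the flow; printed.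

WHAT IS PROVED ([folklore]; 0 `def`, 0 sorry).  §1 **`pair_m1_nonneg`**.  §2 **`pair_c1_le`**.  §3 **`pair_step`**.
-/
noncomputable section
open Finset

namespace Summit.QuantumFields.BalabanUV.Beta.EriceRemainderEnclosureHistoryAutonomyComparisonAgeCompositionStaticChainPairCertificate

open Summit.QuantumFields.BalabanUV.Beta.EriceRemainderEnclosureHistoryAutonomyComparisonAgeCompositionStaticChainObserverRatios
open Summit.QuantumFields.BalabanUV.Beta.EriceRemainderEnclosureHistoryAutonomyComparisonAgeCompositionStaticChainAdjacentCertificate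

/-! ## §1 The first-order margin `m₁ ≥ 0` from four corner polynomials with envelope constants -/

/-- **FIRST ORDER, GENERIC.**  Actual scalars of a step: `κ ≥ 0`, `Ψ = Ψ_yy ≥ 0`, cross amplifications `Pzz, Pyz, Pzy`, window mass `Ω = Ω_z ≥ 0`,
defect `θ`, geometry `σ, φ`, scale ratio `q > 0`.  Envelope constants (any reals satisfying the stated inequalities): sandwich `al·Ψ ≤ Pyz`, `bl·Ψ ≤ Pzy`,
`cl·Ψ ≤ Pzz ≤ ch·Ψ` (`al, bl ≥ 0`), product bound `Ψ·Pzz − D·Ψ² ≤ Pyz·Pzy`, structural room `Ω(l1 + l2Ψ) ≤ rh·Ψ` (`l1 > 0`, `rh ≤ l2`), `θ ≤ th`,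
`0 ≤ sl ≤ σ`, `0 ≤ fl ≤ φ`, `1∕q ≤ rh`.  With `L = l1 + l2Ψ`, `N = l1 + (l2 − rh)Ψ`, `E(c) = sl·fl + sl·bl·Ψ + fl·al·Ψ + Ψ(cΨ) − DΨ²` the FOUR CORNER FACTS
are `L·F(cΨ, N∕L) ≥ 0` and `F(cΨ, 1) ≥ 0` for `c ∈ {cl, ch}`, `F(P,w) = 4κwE − (1+2κΨ)((1+2κP)w − 1 + th) − (1+2κP)rh` — explicit polynomials in `Ψ`.
CONCLUSION: the hypothesis `hm1` of (E78c) `step_of_quadratic_criterion`, `m₁ = 4κΠω − b(aω − 1 + θ) − a∕q ≥ 0` (`Π = (σ+Pyz)(φ+Pzy)`, `ω = 1 − Ω`,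
`a = 1+2κPzz`, `b = 1+2κΨ`).  Proof: `m₁` is monotone in `σ, φ, θ, 1∕q`; then (E78c) `first_order_of_corners` with `ωs = N∕L ≤ ω`. [folklore] -/
theorem pair_m1_nonneg {κ Ψ Pzz Pyz Pzy Ω θ σ φ q sl fl al bl D cl ch th rh l1 l2 : ℝ}
    (hκ : 0 ≤ κ) (hΨ : 0 ≤ Ψ) (hq : 0 < q)
    (hyz : al * Ψ ≤ Pyz) (hzy : bl * Ψ ≤ Pzy) (hzz1 : cl * Ψ ≤ Pzz) (hzz2 : Pzz ≤ ch * Ψ)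
    (hprod : Ψ * Pzz - D * Ψ ^ 2 ≤ Pyz * Pzy)
    (hΩ0 : 0 ≤ Ω) (hroom : Ω * (l1 + l2 * Ψ) ≤ rh * Ψ) (hl1 : 0 < l1) (hl2 : rh ≤ l2)
    (hθ : θ ≤ th) (hσ : sl ≤ σ) (hφ : fl ≤ φ) (hsl : 0 ≤ sl) (hfl : 0 ≤ fl) (hal : 0 ≤ al) (hbl : 0 ≤ bl) (hcl : 0 ≤ cl)
    (hr : 1 / q ≤ rh)
    (hFs_lo : 0 ≤ 4 * κ * (l1 + (l2 - rh) * Ψ) * (sl * fl + sl * bl * Ψ + fl * al * Ψ + Ψ * (cl * Ψ) - D * Ψ ^ 2)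
        - (1 + 2 * κ * Ψ) * ((1 + 2 * κ * (cl * Ψ)) * (l1 + (l2 - rh) * Ψ) - (1 - th) * (l1 + l2 * Ψ))
        - (1 + 2 * κ * (cl * Ψ)) * rh * (l1 + l2 * Ψ))
    (hFs_hi : 0 ≤ 4 * κ * (l1 + (l2 - rh) * Ψ) * (sl * fl + sl * bl * Ψ + fl * al * Ψ + Ψ * (ch * Ψ) - D * Ψ ^ 2)
        - (1 + 2 * κ * Ψ) * ((1 + 2 * κ * (ch * Ψ)) * (l1 + (l2 - rh) * Ψ) - (1 - th) * (l1 + l2 * Ψ))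
        - (1 + 2 * κ * (ch * Ψ)) * rh * (l1 + l2 * Ψ))
    (hF1_lo : 0 ≤ 4 * κ * (sl * fl + sl * bl * Ψ + fl * al * Ψ + Ψ * (cl * Ψ) - D * Ψ ^ 2)
        - (1 + 2 * κ * Ψ) * ((1 + 2 * κ * (cl * Ψ)) - (1 - th)) - (1 + 2 * κ * (cl * Ψ)) * rh)
    (hF1_hi : 0 ≤ 4 * κ * (sl * fl + sl * bl * Ψ + fl * al * Ψ + Ψ * (ch * Ψ) - D * Ψ ^ 2)
        - (1 + 2 * κ * Ψ) * ((1 + 2 * κ * (ch * Ψ)) - (1 - th)) - (1 + 2 * κ * (ch * Ψ)) * rh) :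
    0 ≤ 4 * κ * (σ + Pyz) * (φ + Pzy) * (1 - Ω) - (1 + 2 * κ * Ψ) * ((1 + 2 * κ * Pzz) * (1 - Ω) - 1 + θ) - (1 + 2 * κ * Pzz) / q := by
  have hrq : 0 < 1 / q := by positivity
  have hL : 0 < l1 + l2 * Ψ := by
    have := mul_nonneg (le_trans (le_trans hrq.le hr) hl2) hΨ; linarith only [this, hl1]
  have hN0 : 0 < l1 + (l2 - rh) * Ψ := by
    have := mul_nonneg (sub_nonneg.mpr hl2) hΨ; linarith only [this, hl1]
  have hrh0 : 0 < rh := lt_of_lt_of_le hrq hr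
  have hσ0 : 0 ≤ σ := hsl.trans hσ
  have hφ0 : 0 ≤ φ := hfl.trans hφ
  have hPyz0 : 0 ≤ Pyz := le_trans (mul_nonneg hal hΨ) hyz
  have hPzy0 : 0 ≤ Pzy := le_trans (mul_nonneg hbl hΨ) hzy
  -- the structural window room: `ωs := N/L ≤ 1 − Ω ≤ 1`
  have hωs : (l1 + (l2 - rh) * Ψ) / (l1 + l2 * Ψ) ≤ 1 - Ω := by
    rw [div_le_iff₀ hL]; linarith only [hroom]
  have hω1 : 1 - Ω ≤ 1 := by linarith
  have hωs0 : 0 ≤ (l1 + (l2 - rh) * Ψ) / (l1 + l2 * Ψ) := by positivity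
  -- the four corners with the ACTUAL `σ, φ, θ, q` dominate the envelope corners
  have hF : ∀ P w, (P = cl * Ψ ∨ P = ch * Ψ) → (w = (l1 + (l2 - rh) * Ψ) / (l1 + l2 * Ψ) ∨ w = 1) →
      0 ≤ 4 * κ * w * (σ * φ + σ * bl * Ψ + φ * al * Ψ + Ψ * P - D * Ψ ^ 2) - (1 + 2 * κ * Ψ) * ((1 + 2 * κ * P) * w - 1 + θ)
        - (1 + 2 * κ * P) / q := by
    intro P w hP hw
    have hP0 : 0 ≤ P := by rcases hP with rfl | rfl <;> [exact mul_nonneg hcl hΨ; exact le_trans (le_trans (mul_nonneg hcl hΨ) hzz1) hzz2]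
    have hw0 : 0 ≤ w := by rcases hw with rfl | rfl <;> [exact hωs0; norm_num]
    -- the envelope corner value is non-negative
    have henv : 0 ≤ 4 * κ * w * (sl * fl + sl * bl * Ψ + fl * al * Ψ + Ψ * P - D * Ψ ^ 2) - (1 + 2 * κ * Ψ) * ((1 + 2 * κ * P) * w - 1 + th)
        - (1 + 2 * κ * P) * rh := by
      rcases hw with rfl | rfl
      · -- `w = N/L`: divide the polynomial fact by `L`
        have key : ∀ c : ℝ, 0 ≤ 4 * κ * (l1 + (l2 - rh) * Ψ) * (sl * fl + sl * bl * Ψ + fl * al * Ψ + Ψ * (c * Ψ) - D * Ψ ^ 2)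
            - (1 + 2 * κ * Ψ) * ((1 + 2 * κ * (c * Ψ)) * (l1 + (l2 - rh) * Ψ) - (1 - th) * (l1 + l2 * Ψ))
            - (1 + 2 * κ * (c * Ψ)) * rh * (l1 + l2 * Ψ) →
            0 ≤ 4 * κ * ((l1 + (l2 - rh) * Ψ) / (l1 + l2 * Ψ)) * (sl * fl + sl * bl * Ψ + fl * al * Ψ + Ψ * (c * Ψ) - D * Ψ ^ 2)
              - (1 + 2 * κ * Ψ) * ((1 + 2 * κ * (c * Ψ)) * ((l1 + (l2 - rh) * Ψ) / (l1 + l2 * Ψ)) - 1 + th) - (1 + 2 * κ * (c * Ψ)) * rh := by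
          intro c hc
          have e : 4 * κ * ((l1 + (l2 - rh) * Ψ) / (l1 + l2 * Ψ)) * (sl * fl + sl * bl * Ψ + fl * al * Ψ + Ψ * (c * Ψ) - D * Ψ ^ 2)
              - (1 + 2 * κ * Ψ) * ((1 + 2 * κ * (c * Ψ)) * ((l1 + (l2 - rh) * Ψ) / (l1 + l2 * Ψ)) - 1 + th) - (1 + 2 * κ * (c * Ψ)) * rh
              = (4 * κ * (l1 + (l2 - rh) * Ψ) * (sl * fl + sl * bl * Ψ + fl * al * Ψ + Ψ * (c * Ψ) - D * Ψ ^ 2)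
                - (1 + 2 * κ * Ψ) * ((1 + 2 * κ * (c * Ψ)) * (l1 + (l2 - rh) * Ψ) - (1 - th) * (l1 + l2 * Ψ))
                - (1 + 2 * κ * (c * Ψ)) * rh * (l1 + l2 * Ψ)) / (l1 + l2 * Ψ) := by
            field_simp; ring
          rw [e]; exact div_nonneg hc hL.le
        rcases hP with rfl | rfl
        · exact key cl hFs_lo
        · exact key ch hFs_hi
      · rcases hP with rfl | rfl
        · linarith only [hF1_lo]
        · linarith only [hF1_hi]
    -- monotonicity in `σ, φ, θ, 1/q`
    have hmono : sl * fl + sl * bl * Ψ + fl * al * Ψ ≤ σ * φ + σ * bl * Ψ + φ * al * Ψ := by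
      linarith only [mul_le_mul hσ hφ hfl hσ0, mul_le_mul_of_nonneg_right hσ (mul_nonneg hbl hΨ), mul_le_mul_of_nonneg_right hφ (mul_nonneg hal hΨ)]
    have h1 : 4 * κ * w * (sl * fl + sl * bl * Ψ + fl * al * Ψ + Ψ * P - D * Ψ ^ 2) ≤ 4 * κ * w * (σ * φ + σ * bl * Ψ + φ * al * Ψ + Ψ * P - D * Ψ ^ 2) :=
      mul_le_mul_of_nonneg_left (by linarith) (by positivity)
    have h2 : (1 + 2 * κ * Ψ) * ((1 + 2 * κ * P) * w - 1 + θ) ≤ (1 + 2 * κ * Ψ) * ((1 + 2 * κ * P) * w - 1 + th) :=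
      mul_le_mul_of_nonneg_left (by linarith) (by positivity)
    have h3 : (1 + 2 * κ * P) / q ≤ (1 + 2 * κ * P) * rh := by
      rw [div_eq_mul_one_div]; exact mul_le_mul_of_nonneg_left hr (by positivity)
    linarith
  exact first_order_of_corners hκ hσ0 hφ0 hΨ hal hbl hyz hzy hzz1 hzz2 hprod hωs hω1 hωs0 hF

/-! ## §2 The finite-load criterion `c₁ ≤ λ·m₁` from four corner polynomials with envelope constants -/

/-- **FINITE LOAD, GENERIC.**  Same actual scalars, plus the own weight `s ≥ slo ≥ 1∕2` of the new age (`λ = 2(s+Ψ)`), upper envelopes `σ ≤ su`, `φ ≤ fu`,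
`Pyz ≤ au·Ψ`, `Pzy ≤ bu·Ψ`, the upper product bound `Pyz·Pzy ≤ Ψ·Pzz + D·Ψ²`, `κ ≤ 1`, and `rl ≤ 1∕q ≤ rh`.  With `Φ(c) = su·fu + su·bu·Ψ + fu·au·Ψ + Ψ(cΨ) + DΨ²`
and `B(r) = (1 + 2κΨ − 2slo − 2Ψ)N + r·L` the FOUR CORNER FACTS are `(1+2κcΨ)(1+2κΨ)·r·L − 4κΦ(c)B(r) ≥ 0` for `c ∈ {cl, ch}`, `r ∈ {rl, rh}`.
CONCLUSION: the hypothesis `hc1` of (E78c) `step_of_quadratic_criterion` (via (E78d) `c1_criterion_of_upper`: `4κΦ((b−λ)ω + 1∕q) ≤ ab∕q`).  Proof: the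
bracket is monotone in `s` and — since `b ≤ 2slo + 2Ψ` — in `ω ≥ N∕L`; if the resulting bracket is negative the claim is trivial, otherwise `Π ≤ Φ_actual ≤
Φ(envelopes)` and the corner facts, affine in `r` and in `P` ((E78d) `nonneg_affine_of_ends`). [folklore] -/
theorem pair_c1_le {κ Ψ Pzz Pyz Pzy Ω θ σ φ s q su fu au bu slo D cl ch rl rh l1 l2 : ℝ}
    (hκ : 0 ≤ κ) (hκ1 : κ ≤ 1) (hΨ : 0 ≤ Ψ) (hq : 0 < q)
    (hyz2 : Pyz ≤ au * Ψ) (hzy2 : Pzy ≤ bu * Ψ) (hzz1 : cl * Ψ ≤ Pzz) (hzz2 : Pzz ≤ ch * Ψ) (hPyz0 : 0 ≤ Pyz) (hPzy0 : 0 ≤ Pzy)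
    (hcov : Pyz * Pzy ≤ Ψ * Pzz + D * Ψ ^ 2)
    (hroom : Ω * (l1 + l2 * Ψ) ≤ rh * Ψ) (hl1 : 0 < l1) (hl2 : rh ≤ l2)
    (hσ0 : 0 ≤ σ) (hσ : σ ≤ su) (hφ0 : 0 ≤ φ) (hφ : φ ≤ fu) (hslo : 1 / 2 ≤ slo) (hs : slo ≤ s) (hcl : 0 ≤ cl)
    (hr1 : rl ≤ 1 / q) (hr2 : 1 / q ≤ rh)
    (hG_lo_rl : 0 ≤ (1 + 2 * κ * (cl * Ψ)) * (1 + 2 * κ * Ψ) * rl * (l1 + l2 * Ψ)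
        - 4 * κ * (su * fu + su * bu * Ψ + fu * au * Ψ + Ψ * (cl * Ψ) + D * Ψ ^ 2) * ((1 + 2 * κ * Ψ - 2 * slo - 2 * Ψ) * (l1 + (l2 - rh) * Ψ) + rl * (l1 + l2 * Ψ)))
    (hG_hi_rl : 0 ≤ (1 + 2 * κ * (ch * Ψ)) * (1 + 2 * κ * Ψ) * rl * (l1 + l2 * Ψ)
        - 4 * κ * (su * fu + su * bu * Ψ + fu * au * Ψ + Ψ * (ch * Ψ) + D * Ψ ^ 2) * ((1 + 2 * κ * Ψ - 2 * slo - 2 * Ψ) * (l1 + (l2 - rh) * Ψ) + rl * (l1 + l2 * Ψ)))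
    (hG_lo_rh : 0 ≤ (1 + 2 * κ * (cl * Ψ)) * (1 + 2 * κ * Ψ) * rh * (l1 + l2 * Ψ)
        - 4 * κ * (su * fu + su * bu * Ψ + fu * au * Ψ + Ψ * (cl * Ψ) + D * Ψ ^ 2) * ((1 + 2 * κ * Ψ - 2 * slo - 2 * Ψ) * (l1 + (l2 - rh) * Ψ) + rh * (l1 + l2 * Ψ)))
    (hG_hi_rh : 0 ≤ (1 + 2 * κ * (ch * Ψ)) * (1 + 2 * κ * Ψ) * rh * (l1 + l2 * Ψ)
        - 4 * κ * (su * fu + su * bu * Ψ + fu * au * Ψ + Ψ * (ch * Ψ) + D * Ψ ^ 2) * ((1 + 2 * κ * Ψ - 2 * slo - 2 * Ψ) * (l1 + (l2 - rh) * Ψ) + rh * (l1 + l2 * Ψ))) :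
    4 * κ * ((σ + Pyz) * (φ + Pzy)) * ((1 + 2 * κ * Ψ) * (1 - Ω) + 1 / q) - 2 * (s + Ψ) * (1 + 2 * κ * Ψ) * ((1 + 2 * κ * Pzz) * (1 - Ω) - 1 + θ)
        - (1 + 2 * κ * Pzz) / q * ((1 + 2 * κ * Ψ) + 2 * (s + Ψ))
      ≤ 2 * (s + Ψ) * (4 * κ * ((σ + Pyz) * (φ + Pzy)) * (1 - Ω) - (1 + 2 * κ * Ψ) * ((1 + 2 * κ * Pzz) * (1 - Ω) - 1 + θ) - (1 + 2 * κ * Pzz) / q) := by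
  have hrq : 0 < 1 / q := by positivity
  have hL : 0 < l1 + l2 * Ψ := by
    have := mul_nonneg (le_trans (le_trans hrq.le hr2) hl2) hΨ; linarith only [this, hl1]
  have hN0 : 0 < l1 + (l2 - rh) * Ψ := by
    have := mul_nonneg (sub_nonneg.mpr hl2) hΨ; linarith only [this, hl1]
  have hPzz0 : 0 ≤ Pzz := le_trans (mul_nonneg hcl hΨ) hzz1
  have hPi0 : 0 ≤ (σ + Pyz) * (φ + Pzy) := by positivity
  -- `Π ≤ Φ_actual ≤ Φ_env`
  have hPiPhi : (σ + Pyz) * (φ + Pzy) ≤ su * fu + su * bu * Ψ + fu * au * Ψ + Ψ * Pzz + D * Ψ ^ 2 := by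
    have e : (σ + Pyz) * (φ + Pzy) = σ * φ + σ * Pzy + φ * Pyz + Pyz * Pzy := by ring
    have h1 : σ * Pzy ≤ su * (bu * Ψ) := mul_le_mul hσ hzy2 hPzy0 (hσ0.trans hσ)
    have h2 : φ * Pyz ≤ fu * (au * Ψ) := mul_le_mul hφ hyz2 hPyz0 (hφ0.trans hφ)
    have h3 : σ * φ ≤ su * fu := mul_le_mul hσ hφ hφ0 (hσ0.trans hσ)
    linarith only [e, h1, h2, h3, hcov]
  have hPhi0 : 0 ≤ su * fu + su * bu * Ψ + fu * au * Ψ + Ψ * Pzz + D * Ψ ^ 2 := hPi0.trans hPiPhi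
  have hab : 0 ≤ (1 + 2 * κ * Pzz) * (1 + 2 * κ * Ψ) / q := by positivity
  -- the envelope bracket `B₁ = (b − c)·N/L + 1/q` dominates the actual bracket `(b − λ)ω + 1/q`
  have hbc : 1 + 2 * κ * Ψ - 2 * slo - 2 * Ψ ≤ 0 := by
    have := mul_le_mul_of_nonneg_right hκ1 hΨ; linarith only [this, hslo]
  have hωs : (l1 + (l2 - rh) * Ψ) / (l1 + l2 * Ψ) ≤ 1 - Ω := by rw [div_le_iff₀ hL]; linarith only [hroom]
  have hB : ((1 + 2 * κ * Ψ) - 2 * (s + Ψ)) * (1 - Ω) + 1 / q ≤ (1 + 2 * κ * Ψ - 2 * slo - 2 * Ψ) * ((l1 + (l2 - rh) * Ψ) / (l1 + l2 * Ψ)) + 1 / q := by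
    have hω0 : 0 ≤ 1 - Ω := le_trans (div_nonneg hN0.le hL.le) hωs
    have h1 : ((1 + 2 * κ * Ψ) - 2 * (s + Ψ)) * (1 - Ω) ≤ (1 + 2 * κ * Ψ - 2 * slo - 2 * Ψ) * (1 - Ω) :=
      mul_le_mul_of_nonneg_right (by linarith only [hs]) hω0
    have h2 : (1 + 2 * κ * Ψ - 2 * slo - 2 * Ψ) * (1 - Ω) ≤ (1 + 2 * κ * Ψ - 2 * slo - 2 * Ψ) * ((l1 + (l2 - rh) * Ψ) / (l1 + l2 * Ψ)) :=
      mul_le_mul_of_nonpos_left hωs hbc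
    linarith
  have hG : 4 * κ * (su * fu + su * bu * Ψ + fu * au * Ψ + Ψ * Pzz + D * Ψ ^ 2) * (((1 + 2 * κ * Ψ) - 2 * (s + Ψ)) * (1 - Ω) + 1 / q)
      ≤ (1 + 2 * κ * Pzz) * (1 + 2 * κ * Ψ) / q := by
    have step1 : 4 * κ * (su * fu + su * bu * Ψ + fu * au * Ψ + Ψ * Pzz + D * Ψ ^ 2) * (((1 + 2 * κ * Ψ) - 2 * (s + Ψ)) * (1 - Ω) + 1 / q)
        ≤ 4 * κ * (su * fu + su * bu * Ψ + fu * au * Ψ + Ψ * Pzz + D * Ψ ^ 2) * ((1 + 2 * κ * Ψ - 2 * slo - 2 * Ψ) * ((l1 + (l2 - rh) * Ψ) / (l1 + l2 * Ψ)) + 1 / q) :=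
      mul_le_mul_of_nonneg_left hB (by positivity)
    refine step1.trans ?_
    -- the corner polynomials: `L · [a b r − 4κΦ(P)((b−c)N/L + r)] ≥ 0` is affine in `r ∈ [rl, rh]` and in `P ∈ [clΨ, chΨ]`
    have hcore : ∀ r : ℝ, (r = rl ∨ r = rh) → 0 ≤ (1 + 2 * κ * Pzz) * (1 + 2 * κ * Ψ) * r * (l1 + l2 * Ψ)
        - 4 * κ * (su * fu + su * bu * Ψ + fu * au * Ψ + Ψ * Pzz + D * Ψ ^ 2) * ((1 + 2 * κ * Ψ - 2 * slo - 2 * Ψ) * (l1 + (l2 - rh) * Ψ) + r * (l1 + l2 * Ψ)) := by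
      intro r hr
      -- affine in `P`: write as `c0 + c1·P` and interpolate between the corners `clΨ`, `chΨ`
      have e : ∀ P : ℝ, (1 + 2 * κ * P) * (1 + 2 * κ * Ψ) * r * (l1 + l2 * Ψ)
          - 4 * κ * (su * fu + su * bu * Ψ + fu * au * Ψ + Ψ * P + D * Ψ ^ 2) * ((1 + 2 * κ * Ψ - 2 * slo - 2 * Ψ) * (l1 + (l2 - rh) * Ψ) + r * (l1 + l2 * Ψ))
          = ((1 + 2 * κ * Ψ) * r * (l1 + l2 * Ψ) - 4 * κ * (su * fu + su * bu * Ψ + fu * au * Ψ + D * Ψ ^ 2) * ((1 + 2 * κ * Ψ - 2 * slo - 2 * Ψ) * (l1 + (l2 - rh) * Ψ) + r * (l1 + l2 * Ψ)))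
            + (2 * κ * (1 + 2 * κ * Ψ) * r * (l1 + l2 * Ψ) - 4 * κ * Ψ * ((1 + 2 * κ * Ψ - 2 * slo - 2 * Ψ) * (l1 + (l2 - rh) * Ψ) + r * (l1 + l2 * Ψ))) * P := by
        intro P; ring
      rw [e]
      refine nonneg_affine_of_ends hzz1 hzz2 ?_ ?_
      · rw [← e]; rcases hr with rfl | rfl
        · exact hG_lo_rl
        · exact hG_lo_rh
      · rw [← e]; rcases hr with rfl | rfl
        · exact hG_hi_rl
        · exact hG_hi_rh
    -- affine in `r`: interpolate between `rl` and `rh` at `r = 1/q`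
    have er : ∀ r : ℝ, (1 + 2 * κ * Pzz) * (1 + 2 * κ * Ψ) * r * (l1 + l2 * Ψ)
        - 4 * κ * (su * fu + su * bu * Ψ + fu * au * Ψ + Ψ * Pzz + D * Ψ ^ 2) * ((1 + 2 * κ * Ψ - 2 * slo - 2 * Ψ) * (l1 + (l2 - rh) * Ψ) + r * (l1 + l2 * Ψ))
        = (-(4 * κ * (su * fu + su * bu * Ψ + fu * au * Ψ + Ψ * Pzz + D * Ψ ^ 2) * ((1 + 2 * κ * Ψ - 2 * slo - 2 * Ψ) * (l1 + (l2 - rh) * Ψ))))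
          + ((1 + 2 * κ * Pzz) * (1 + 2 * κ * Ψ) * (l1 + l2 * Ψ) - 4 * κ * (su * fu + su * bu * Ψ + fu * au * Ψ + Ψ * Pzz + D * Ψ ^ 2) * (l1 + l2 * Ψ)) * r := by
      intro r; ring
    have hq' : 0 ≤ (1 + 2 * κ * Pzz) * (1 + 2 * κ * Ψ) * (1 / q) * (l1 + l2 * Ψ)
        - 4 * κ * (su * fu + su * bu * Ψ + fu * au * Ψ + Ψ * Pzz + D * Ψ ^ 2) * ((1 + 2 * κ * Ψ - 2 * slo - 2 * Ψ) * (l1 + (l2 - rh) * Ψ) + (1 / q) * (l1 + l2 * Ψ)) := by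
      rw [er]
      refine nonneg_affine_of_ends hr1 hr2 ?_ ?_
      · rw [← er]; exact hcore rl (Or.inl rfl)
      · rw [← er]; exact hcore rh (Or.inr rfl)
    -- divide by `L`
    have hdiv : (1 + 2 * κ * Ψ - 2 * slo - 2 * Ψ) * ((l1 + (l2 - rh) * Ψ) / (l1 + l2 * Ψ)) + 1 / q
        = ((1 + 2 * κ * Ψ - 2 * slo - 2 * Ψ) * (l1 + (l2 - rh) * Ψ) + (1 / q) * (l1 + l2 * Ψ)) / (l1 + l2 * Ψ) := by
      rw [mul_div_assoc', div_add' _ _ _ hL.ne']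
    rw [hdiv, mul_div_assoc', div_le_iff₀ hL]
    have e5 : (1 + 2 * κ * Pzz) * (1 + 2 * κ * Ψ) / q * (l1 + l2 * Ψ) = (1 + 2 * κ * Pzz) * (1 + 2 * κ * Ψ) * (1 / q) * (l1 + l2 * Ψ) := by ring
    rw [e5]
    linarith only [hq']
  have key := c1_criterion_of_upper (a := 1 + 2 * κ * Pzz) (b := 1 + 2 * κ * Ψ) (ω := 1 - Ω) (θ := θ) (q := q)
    (P := (σ + Pyz) * (φ + Pzy)) (Φ := su * fu + su * bu * Ψ + fu * au * Ψ + Ψ * Pzz + D * Ψ ^ 2) (κ := κ) (lam := 2 * (s + Ψ))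
    hκ hPi0 hPiPhi hab hG
  -- letters
  have e4 : (1 + 2 * κ * Pzz) / q * ((1 + 2 * κ * Ψ) + 2 * (s + Ψ)) = (1 + 2 * κ * Pzz) / q * ((1 + 2 * κ * Ψ) + 2 * (s + Ψ)) := rfl
  linarith [key]

/-! ## §3 The step at every admissible load -/

/-- **THE OBSERVER STEP (◆) FOR A GENERIC PAIR, FROM ENVELOPE CONSTANTS AND CORNER POLYNOMIALS.**  Hypotheses: those of `pair_m1_nonneg` and `pair_c1_le`,
the pole polynomial `rh·L ≤ 2(slo + Ψ)·N` (so that `λqω ≥ 1`), and the new age's load `0 ≤ x` below its cap `2x(s+Ψ) < 1` ((E78b) `pivot_pos`).  CONCLUSION: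
the hypothesis `hdia` of (E78a) `observer_step` in the letters of (E78g) `adjacent_step` with a general scale ratio `q`:
**`(1+2κPzz)(1−Ω) − (1−θ)x(1+2κΨ) ≤ [1 − x(1+2κΨ)]·[1 + 2κPzz + 4κxΠ∕(1 − 2(s+Ψ)x)]·(1 − Ω − x∕q)`** — the observer bound `N_z ≤ (1+2κΨ_zz)(1−Ω_z)` PROPAGATES
through the addition of the age `y`.  Every geometry class of route (N′) (adjacent `z ≤ 15`, the `q`-bands, the far pairs) is an INSTANCE: rational constants,
eight polynomial facts, envelope lemmas. [folklore] -/
theorem pair_step {κ Ψ Pzz Pyz Pzy Ω θ σ φ s q x sl su fl fu al au bl bu slo D cl ch th rl rh l1 l2 : ℝ}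
    (hκ : 0 ≤ κ) (hκ1 : κ ≤ 1) (hΨ : 0 ≤ Ψ) (hq : 0 < q)
    (hyz1 : al * Ψ ≤ Pyz) (hyz2 : Pyz ≤ au * Ψ) (hzy1 : bl * Ψ ≤ Pzy) (hzy2 : Pzy ≤ bu * Ψ) (hzz1 : cl * Ψ ≤ Pzz) (hzz2 : Pzz ≤ ch * Ψ)
    (hcov1 : Ψ * Pzz - D * Ψ ^ 2 ≤ Pyz * Pzy) (hcov2 : Pyz * Pzy ≤ Ψ * Pzz + D * Ψ ^ 2)
    (hΩ0 : 0 ≤ Ω) (hroom : Ω * (l1 + l2 * Ψ) ≤ rh * Ψ) (hl1 : 0 < l1) (hl2 : rh ≤ l2)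
    (hθ : θ ≤ th) (hsl : 0 ≤ sl) (hσ1 : sl ≤ σ) (hσ2 : σ ≤ su) (hfl : 0 ≤ fl) (hφ1 : fl ≤ φ) (hφ2 : φ ≤ fu)
    (hslo : 1 / 2 ≤ slo) (hs : slo ≤ s) (hal : 0 ≤ al) (hbl : 0 ≤ bl) (hcl : 0 ≤ cl)
    (hr1 : rl ≤ 1 / q) (hr2 : 1 / q ≤ rh)
    (hFs_lo : 0 ≤ 4 * κ * (l1 + (l2 - rh) * Ψ) * (sl * fl + sl * bl * Ψ + fl * al * Ψ + Ψ * (cl * Ψ) - D * Ψ ^ 2)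
        - (1 + 2 * κ * Ψ) * ((1 + 2 * κ * (cl * Ψ)) * (l1 + (l2 - rh) * Ψ) - (1 - th) * (l1 + l2 * Ψ))
        - (1 + 2 * κ * (cl * Ψ)) * rh * (l1 + l2 * Ψ))
    (hFs_hi : 0 ≤ 4 * κ * (l1 + (l2 - rh) * Ψ) * (sl * fl + sl * bl * Ψ + fl * al * Ψ + Ψ * (ch * Ψ) - D * Ψ ^ 2)
        - (1 + 2 * κ * Ψ) * ((1 + 2 * κ * (ch * Ψ)) * (l1 + (l2 - rh) * Ψ) - (1 - th) * (l1 + l2 * Ψ))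
        - (1 + 2 * κ * (ch * Ψ)) * rh * (l1 + l2 * Ψ))
    (hF1_lo : 0 ≤ 4 * κ * (sl * fl + sl * bl * Ψ + fl * al * Ψ + Ψ * (cl * Ψ) - D * Ψ ^ 2)
        - (1 + 2 * κ * Ψ) * ((1 + 2 * κ * (cl * Ψ)) - (1 - th)) - (1 + 2 * κ * (cl * Ψ)) * rh)
    (hF1_hi : 0 ≤ 4 * κ * (sl * fl + sl * bl * Ψ + fl * al * Ψ + Ψ * (ch * Ψ) - D * Ψ ^ 2)
        - (1 + 2 * κ * Ψ) * ((1 + 2 * κ * (ch * Ψ)) - (1 - th)) - (1 + 2 * κ * (ch * Ψ)) * rh)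
    (hG_lo_rl : 0 ≤ (1 + 2 * κ * (cl * Ψ)) * (1 + 2 * κ * Ψ) * rl * (l1 + l2 * Ψ)
        - 4 * κ * (su * fu + su * bu * Ψ + fu * au * Ψ + Ψ * (cl * Ψ) + D * Ψ ^ 2) * ((1 + 2 * κ * Ψ - 2 * slo - 2 * Ψ) * (l1 + (l2 - rh) * Ψ) + rl * (l1 + l2 * Ψ)))
    (hG_hi_rl : 0 ≤ (1 + 2 * κ * (ch * Ψ)) * (1 + 2 * κ * Ψ) * rl * (l1 + l2 * Ψ)
        - 4 * κ * (su * fu + su * bu * Ψ + fu * au * Ψ + Ψ * (ch * Ψ) + D * Ψ ^ 2) * ((1 + 2 * κ * Ψ - 2 * slo - 2 * Ψ) * (l1 + (l2 - rh) * Ψ) + rl * (l1 + l2 * Ψ)))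
    (hG_lo_rh : 0 ≤ (1 + 2 * κ * (cl * Ψ)) * (1 + 2 * κ * Ψ) * rh * (l1 + l2 * Ψ)
        - 4 * κ * (su * fu + su * bu * Ψ + fu * au * Ψ + Ψ * (cl * Ψ) + D * Ψ ^ 2) * ((1 + 2 * κ * Ψ - 2 * slo - 2 * Ψ) * (l1 + (l2 - rh) * Ψ) + rh * (l1 + l2 * Ψ)))
    (hG_hi_rh : 0 ≤ (1 + 2 * κ * (ch * Ψ)) * (1 + 2 * κ * Ψ) * rh * (l1 + l2 * Ψ)
        - 4 * κ * (su * fu + su * bu * Ψ + fu * au * Ψ + Ψ * (ch * Ψ) + D * Ψ ^ 2) * ((1 + 2 * κ * Ψ - 2 * slo - 2 * Ψ) * (l1 + (l2 - rh) * Ψ) + rh * (l1 + l2 * Ψ)))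
    (hpole : rh * (l1 + l2 * Ψ) ≤ 2 * (slo + Ψ) * (l1 + (l2 - rh) * Ψ))
    (hx : 0 ≤ x) (hcap : 2 * x * (s + Ψ) < 1) :
    (1 + 2 * κ * Pzz) * (1 - Ω) - (1 - θ) * (x * (1 + 2 * κ * Ψ))
      ≤ (1 - x * (1 + 2 * κ * Ψ)) *
        ((1 + 2 * κ * Pzz + 4 * κ * x * ((σ + Pyz) * (φ + Pzy)) / (1 - 2 * (s + Ψ) * x)) * ((1 - Ω) - x / q)) := by
  have hrq : 0 < 1 / q := by positivity
  have hL : 0 < l1 + l2 * Ψ := by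
    have := mul_nonneg (le_trans (le_trans hrq.le hr2) hl2) hΨ; linarith only [this, hl1]
  have hN0 : 0 < l1 + (l2 - rh) * Ψ := by
    have := mul_nonneg (sub_nonneg.mpr hl2) hΨ; linarith only [this, hl1]
  have hrh0 : 0 < rh := lt_of_lt_of_le hrq hr2
  have hσ0 : 0 ≤ σ := hsl.trans hσ1
  have hφ0 : 0 ≤ φ := hfl.trans hφ1
  have hPyz0 : 0 ≤ Pyz := le_trans (mul_nonneg hal hΨ) hyz1
  have hPzy0 : 0 ≤ Pzy := le_trans (mul_nonneg hbl hΨ) hzy1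
  have hPi0 : 0 ≤ (σ + Pyz) * (φ + Pzy) := by positivity
  -- (1) first order and (2) finite load
  have hm1 := pair_m1_nonneg hκ hΨ hq hyz1 hzy1 hzz1 hzz2 hcov1 hΩ0 hroom hl1 hl2 hθ hσ1 hφ1 hsl hfl hal hbl hcl hr2 hFs_lo hFs_hi hF1_lo hF1_hi
  have hc1 := pair_c1_le (θ := θ) hκ hκ1 hΨ hq hyz2 hzy2 hzz1 hzz2 hPyz0 hPzy0 hcov2 hroom hl1 hl2 hσ0 hσ2 hφ0 hφ2 hslo hs hcl hr1 hr2
    hG_lo_rl hG_hi_rl hG_lo_rh hG_hi_rh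
  -- (3) the pole condition `λ q ω ≥ 1` from the room and the pole polynomial
  have hωs : (l1 + (l2 - rh) * Ψ) / (l1 + l2 * Ψ) ≤ 1 - Ω := by rw [div_le_iff₀ hL]; linarith only [hroom]
  have hω0 : 0 < 1 - Ω := lt_of_lt_of_le (by positivity) hωs
  have hlam : 0 < 2 * (s + Ψ) := by linarith
  have hqr : 1 ≤ q * rh := by
    have := mul_le_mul_of_nonneg_left hr2 hq.le
    rwa [mul_one_div_cancel hq.ne'] at this
  have hpole' : 1 ≤ 2 * (s + Ψ) * q * (1 - Ω) := by
    -- `2(s+Ψ) q ω ≥ 2(slo+Ψ) · q · N/L ≥ q rh ≥ 1` using `2(slo+Ψ)N ≥ rh L`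
    have h1 : rh ≤ 2 * (slo + Ψ) * ((l1 + (l2 - rh) * Ψ) / (l1 + l2 * Ψ)) := by
      rw [mul_div_assoc', le_div_iff₀ hL]; linarith
    have h2 : 2 * (slo + Ψ) * ((l1 + (l2 - rh) * Ψ) / (l1 + l2 * Ψ)) ≤ 2 * (s + Ψ) * (1 - Ω) :=
      mul_le_mul (by linarith) hωs (by positivity) (by linarith)
    have h3 : q * rh ≤ q * (2 * (s + Ψ) * (1 - Ω)) := mul_le_mul_of_nonneg_left (h1.trans h2) hq.le
    linarith only [h3, hqr]
  have hbl' : 1 + 2 * κ * Ψ ≤ 2 * (s + Ψ) := by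
    have := mul_le_mul_of_nonneg_right hκ1 hΨ; linarith only [this, hslo, hs]
  have hul : 2 * (s + Ψ) * x < 1 := by linarith [show 2 * (s + Ψ) * x = 2 * x * (s + Ψ) by ring]
  have hκP : 0 ≤ κ * ((σ + Pyz) * (φ + Pzy)) := mul_nonneg hκ hPi0
  have hm1' : 0 ≤ 4 * κ * ((σ + Pyz) * (φ + Pzy)) * (1 - Ω) - (1 + 2 * κ * Ψ) * ((1 + 2 * κ * Pzz) * (1 - Ω) - 1 + θ) - (1 + 2 * κ * Pzz) / q := by
    have e : 4 * κ * ((σ + Pyz) * (φ + Pzy)) * (1 - Ω) = 4 * κ * (σ + Pyz) * (φ + Pzy) * (1 - Ω) := by ring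
    rw [e]; exact hm1
  have hstep := step_of_quadratic_criterion (a := 1 + 2 * κ * Pzz) (b := 1 + 2 * κ * Ψ) (ω := 1 - Ω) (θ := θ) (q := q)
    (P := (σ + Pyz) * (φ + Pzy)) (κ := κ) (lam := 2 * (s + Ψ)) (u := x)
    hx hul hlam hq hκP hbl' hpole' hm1' hc1
  have e3 : (1 - θ) * (x * (1 + 2 * κ * Ψ)) = (1 - θ) * ((1 + 2 * κ * Ψ) * x) := by ring
  have e4 : (1 - x * (1 + 2 * κ * Ψ)) = (1 - (1 + 2 * κ * Ψ) * x) := by ring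
  rw [e3, e4]
  exact hstep

end Summit.QuantumFields.BalabanUV.Beta.EriceRemainderEnclosureHistoryAutonomyComparisonAgeCompositionStaticChainPairCertificate

end
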